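import Summits.ResolutionOfSingularities.ResolutionOfSingularities.Theorems.EquisingularLiftEquisingularLiftNatNoseLiftRung
import Summits.ResolutionOfSingularities.ResolutionOfSingularities.Theorems.EquisingularLiftEquisingularLiftNatNoseTowerZeroPrimeDriver
import HarnessLib

/-!
# [OURS · L1 W4.5(b) · EL♮(3) · WIDTH TABLE D17 «STAGE-0 TOWER BOOKKEEPING», rung row] RUNG^{τ0′} ★★ `nose_tower_rung_three`
# `(T-k) → p.Prime → ∀ k … → NoseHypHostedNestEquinodalDirectCILiftTowerZeroPrimeSigmaPGBTriplePrime₂ k 3 H ι → ELNatConclusionO k 3 H ι` (binder = RUNG^{νLIFT}'s VERBATIM)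

res-L1-w45b-nose-w1 g7 (WIDTH seat D-0157 DOOR 1; desk RULING R82 (A) «… + the RUNG `nose_tower_rung_three` in `Theorems/…NatNoseTowerZeroRung.lean`», NAME FLAG
g27-24 «type the RUNG as `… → NoseHypHostedNestEquinodalDirectCILiftTowerZeroPrimeSigmaPGBTriplePrime₂ k 3 H ι → ELNatConclusionO k 3 H ι`»).  = ✓ RUNG^{νLIFT}
`nose_lift_rung_three` (…NatNoseLiftRung, this seat p717652) BYTE-FOR-BYTE with: the blob token `…DirectCILiftSigmaPGBTriplePrime₂ ↦
…DirectCILiftTowerZeroPrimeSigmaPGBTriplePrime₂` (res-type-027 ✓ …DefsE9Prime p720678, the blob OF RECORD), `ReachI := (((ν4 ∨ ν3ᵈΣPG) ∨ ν3ᶜⁱΣPG) ∨ νLIFT) ∨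
ReachTowerNose₀Prime k 3 (range ι)`, and ONE more `Or.elim` arm served by ✓ `Tower.hsubtower₀Prime_of_door` (…NatNoseTowerZeroPrimeDriver: the D17 engine (n3)
seed + stage-0 carrier + (T1′)/(pt-ram)/(T2) closures + `invB₄_final` exit); ZERO change to the K5ⁱ engine ✓ `target_elnat_of_hostedSubchainResolutionᵢ`.
OURS; NOT a statement of any manuscript ([Hironaka2017] is a candidate under adjudication, nothing of it is asserted); AI-written, weaker than expert review.
No `sorry`; standard axioms; DEF-FREE; the ONLY hypothesis is (T-k) `EmbeddedCurveLiftFact` (the registered `stub_elnat_embeddedCurveLiftFact`).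
`--supports stmt-ResolutionOfSingularities-20148 --as helper`, counted 0.  EL♮(3) is NOT proved here: after the 52nd REPLACE the nose residue reads
`¬ NoseHypHostedNestEquinodalDirectCILiftTowerZeroPrimeSigmaPGBTriplePrime₂`; resolution of singularities in positive characteristic is NOT proved anywhere in
this tree (dim 3 in print: Cossart–Piltant 2008/2009). [folklore; pure composition of ✓ modules]
-/

set_option linter.dupNamespace false -- mandated namespace `Summit.<Summit>.<Problem>` of this single-conjunct summit
set_option linter.overlappingInstances false -- signatures carry `[IsDomain O] [IsDiscreteValuationRing O]`

noncomputable section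

open CategoryTheory CategoryTheory.Limits AlgebraicGeometry TopologicalSpace Topology IsLocalRing
open MvPolynomial
open Literature.AlgebraicGeometry.Resolution
open AlgebraicGeometry.Scheme.IdealSheafData
open Summit.ResolutionOfSingularities.ResolutionOfSingularities.Theses.EquisingularLift.Split
open Summit.ResolutionOfSingularities.ResolutionOfSingularities.Cruxes.EquisingularLift.StrataSplit

namespace Summit.ResolutionOfSingularities.ResolutionOfSingularities.Cruxes.EquisingularLiftNat.Sections

/-- ★★ **THE RUNG (R-τ0′) `nose_tower_rung_three`: surfaces `H ⊂ ℙ³_k` whose downstairs nose resolution uses the initial menu «(((ν4 ∨ ν3ᵈΣPG) ∨ ν3ᶜⁱΣPG) ∨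
νLIFT) ∨ τ0′» (res-type-027's blob E9′ `NoseHypHostedNestEquinodalDirectCILiftTowerZeroPrimeSigmaPGBTriplePrime₂`, WIDTH TABLE D17 «STAGE-0 TOWER», desk R81–R83)
satisfy EL♮(3)'s conclusion, GIVEN (T-k).**  = ✓ `nose_lift_rung_three` with ONE more `Or.elim` arm served by `Tower.hsubtower₀Prime_of_door`; binder convention =
RUNG^{νLIFT}'s VERBATIM, blob token swapped (desk kit call: `nose_tower_rung_three p stub_elnat_embeddedCurveLiftFact hp k H ι hι hH hloc hTOWER`).
ONE call of ✓ K5ⁱ `target_elnat_of_hostedSubchainResolutionᵢ` — zero engine change; both licences of the older arms discharged inside as in RUNG^{νLIFT}.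
[OURS · L1 W4.5b · rung of the 52nd REPLACE «¬blob_E8 ↦ ¬blob_E9′»; NOT a statement of the manuscript; EL♮(3) NOT proved] -/
theorem nose_tower_rung_three (p : ℕ) : EmbeddedCurveLiftFact → p.Prime →
    ∀ (k : Type) [Field k] [CharP k p] [IsAlgClosed k] (H : AlgebraicGeometry.Scheme.{0})
    (ι : H ⟶ (Literature.AlgebraicGeometry.Motives.projectiveSpace 3 k).left),
    AlgebraicGeometry.IsClosedImmersion ι → AlgebraicGeometry.IsIntegral H →
    (∀ y : (Literature.AlgebraicGeometry.Motives.projectiveSpace 3 k).left,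
      ∃ U : (Literature.AlgebraicGeometry.Motives.projectiveSpace 3 k).left.affineOpens,
        y ∈ (U : (Literature.AlgebraicGeometry.Motives.projectiveSpace 3 k).left.Opens) ∧ (ι.ker.ideal U).IsPrincipal) →
    NoseHypHostedNestEquinodalDirectCILiftTowerZeroPrimeSigmaPGBTriplePrime₂ k 3 H ι → ELNatConclusionO k 3 H ι := by
  intro hF hp k _ _ _ H ι hι hH hloc hν
  haveI := hι; haveI := hH
  letI := MvPolynomial.gradedAlgebra (σ := Fin (3 + 1)) (R := k)
  obtain ⟨E₀, hE₀, hres⟩ := hν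
  -- F4's outer hypothesis on the initial host (the blob's disjunction minus its `¬ range ι ⊆ V₊ ℓ` conjunct); read by JINIT (ν4) and by HSUBᵈ (ν3ᵈ)
  have hE₀' : E₀ = ∅ ∨ ∃ ℓ₀ : MvPolynomial (Fin (3 + 1)) k, ℓ₀.IsHomogeneous 1 ∧ ℓ₀ ≠ 0 ∧
      E₀ = {y : (Literature.AlgebraicGeometry.Motives.projectiveSpace 3 k).left | ℓ₀ ∈ (y : ProjectiveSpectrum (MvPolynomial.homogeneousSubmodule (Fin (3 + 1)) k)).asHomogeneousIdeal} :=
    hE₀.imp id (fun ⟨ℓ₀, h1, h0, _, h⟩ => ⟨ℓ₀, h1, h0, h⟩)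
  -- HINIT by cases on the host; everything else is host-independent
  have HINIT : ∀ (O : Type) [CommRing O] [IsDomain O] [IsDiscreteValuationRing O] [IsAdicComplete (IsLocalRing.maximalIdeal O) O]
      [IsAlgClosed (IsLocalRing.ResidueField O)] (θ : O →+* k), Function.Surjective θ → (letI := MvPolynomial.gradedAlgebra (σ := Fin (3 + 1)) (R := O);
      letI := MvPolynomial.gradedAlgebra (σ := Fin (3 + 1)) (R := k); ∀ (φ : MvPolynomial.homogeneousSubmodule (Fin (3 + 1)) O →+*ᵍ MvPolynomial.homogeneousSubmodule (Fin (3 + 1)) k)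
        (hφ' : HomogeneousIdeal.irrelevant (MvPolynomial.homogeneousSubmodule (Fin (3 + 1)) k) ≤ (HomogeneousIdeal.irrelevant (MvPolynomial.homogeneousSubmodule (Fin (3 + 1)) O)).map φ), (∀ s, φ s = MvPolynomial.map θ s) →
        TCPlus.LetterDatum O (AlgebraicGeometry.Proj (MvPolynomial.homogeneousSubmodule (Fin (3 + 1)) O)) (AlgebraicGeometry.Proj.toSpecZero (MvPolynomial.homogeneousSubmodule (Fin (3 + 1)) O) ≫ AlgebraicGeometry.Spec.map (CommRingCat.ofHom (algebraMap O (MvPolynomial.homogeneousSubmodule (Fin (3 + 1)) O 0)))) (Set.range (ι ≫ AlgebraicGeometry.Proj.map φ hφ' : H ⟶ (AlgebraicGeometry.Proj (MvPolynomial.homogeneousSubmodule (Fin (3 + 1)) O)))) (Literature.AlgebraicGeometry.Motives.projectiveSpace 3 k).left (AlgebraicGeometry.Proj (MvPolynomial.homogeneousSubmodule (Fin (3 + 1)) O)) (𝟙 (AlgebraicGeometry.Proj (MvPolynomial.homogeneousSubmodule (Fin (3 + 1)) O))) (AlgebraicGeometry.Proj.map φ hφ' : (Literature.AlgebraicGeometry.Motives.projectiveSpace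 3 k).left ⟶ (AlgebraicGeometry.Proj (MvPolynomial.homogeneousSubmodule (Fin (3 + 1)) O))) E₀) := by
    rcases hE₀ with rfl | ⟨ℓ, hℓ1, hℓ0, hHℓ, rfl⟩
    · exact hinit_empty k 3 H ι
    · exact hinit_hyperplane k 2 H ι ℓ hℓ1 hℓ0 hHℓ
  exact target_elnat_of_hostedSubchainResolutionᵢ p hp k 3 H ι hι hH hloc E₀ ReachHostedNoseBTriplePrime
    (fun ℓ F₉ β T₉ E₉ => (((ReachEquinodalPlanarNose₂ k 3 ℓ (Set.range ι) F₉ β T₉ E₉ ∨ ReachDirectPlanarNoseSigmaPG₂ k 3 ℓ (Set.range ι) F₉ β T₉ E₉) ∨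
      ReachDirectCINoseSigmaPG₂ k 3 (Set.range ι) F₉ β T₉ E₉) ∨ ReachLiftNoseSigmaPG₂ k 3 H ι (Set.range ι) F₉ β T₉ E₉) ∨
      ReachTowerNose₀Prime k 3 (Set.range ι) F₉ β T₉ E₉)
    HINIT (TCPlus.hpt_seam k 3) (TCPlus.hround_seam k hF) (hsubh_reachHostedNoseBTriplePrime_of_embeddedCurveLiftFact hF k)
    (fun O _ _ _ _ _ θ hθ φ hφ' hφ Ch hChStep hChSplit hYsp hYirr hYcl hPint hPnoeth hPreg hqprop hqsm hCh₀ h𝓔₀ ℓ' F₉ β T₉ E₉ hE₀ hR =>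
      hR.elim (fun hR => hR.elim (fun hR => hR.elim (fun hR => hR.elim
        (fun hR => Equinodal.hsube_of_suppliers hF k O θ hθ _ _ _ Ch hChStep hChSplit hYsp hYirr hYcl hPint hPnoeth hPreg hqprop hqsm ℓ' (Set.range ι)
          (Equinodal.RPlus k O θ _ _ _ Ch)
          (Equinodal.jinit_rPlus₀_of_nearNode k H ι hι hH _ hE₀' (Equinodal.nose_regular_near_node k) O θ hθ φ hφ' hφ Ch hChStep hChSplit hYsp hYirr hYcl
            hPint hPnoeth hPreg hqprop hqsm hCh₀ h𝓔₀ ℓ' hE₀)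
          (Equinodal.hnode_rPlus k O θ hθ _ _ _ Ch hChStep hChSplit hYsp hYirr hYcl hPint hPnoeth hPreg hqprop hqsm)
          (Equinodal.hrdz_rPlus k O θ hθ _ _ _ Ch hChStep hChSplit hYsp hYirr hYcl hPint hPnoeth hPreg hqprop hqsm (hF k O θ hθ _ _))
          (Equinodal.hend_rPlus k O θ _ _ _ Ch) F₉ β T₉ E₉ hR)
        (fun hR => Direct.hsubd_sigmaPG_of_smoothing hF k H ι hι hH E₀ hE₀' O θ hθ (SecCurve.secCurveLift k O θ hθ) φ hφ' hφ Ch hChStep hChSplit hYsp hYirr hYcl hPint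
          hPnoeth hPreg hqprop hqsm hCh₀ h𝓔₀ ℓ' F₉ β T₉ E₉ hE₀ hR))
        (fun hR => Direct.hsubci_sigmaPG_of_smoothing hF k H ι hι hH E₀ O θ hθ (SecCurve.secCurveLift k O θ hθ) φ hφ' hφ Ch hChStep hChSplit hYsp hYirr hYcl hPint hPnoeth
          hPreg hqprop hqsm hCh₀ h𝓔₀ ℓ' F₉ β T₉ E₉ hE₀ hR))
        (fun hR => LiftNose.hsublift_of_door hF k H ι hι hH E₀ O θ hθ (SecCurve.secCurveLift k O θ hθ) φ hφ' hφ Ch hChStep hChSplit hYsp hYirr hYcl hPint hPnoeth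
          hPreg hqprop hqsm hCh₀ h𝓔₀ ℓ' F₉ β T₉ E₉ hE₀ hR))
        (fun hR => Tower.hsubtower₀Prime_of_door hF k H ι hι hH E₀ O θ hθ φ hφ' hφ Ch hChStep hChSplit hYsp hYirr hYcl hPint hPnoeth hPreg hqprop hqsm hCh₀ h𝓔₀ ℓ'
          F₉ β T₉ E₉ hE₀ hR))
    hres

end Summit.ResolutionOfSingularities.ResolutionOfSingularities.Cruxes.EquisingularLiftNat.Sections

end
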